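import Mathlib
import Summits.NavierStokesRegularity.NavierStokesRegularity.Theorems.EulerZoomLiouvillePowerGaugeEulerLiouvilleVorticityBirth
import Summits.NavierStokesRegularity.NavierStokesRegularity.Theorems.EulerZoomLiouvillePowerGaugeEulerLiouvilleSimilarityBernoulli
import HarnessLib.Audit

/-!
# Crux E `PowerGaugeEulerLiouville` (stmt-NavierStokesRegularity-19832): CONFINED BACKWARD TRAJECTORIES WITH A SIMILARITY-SPEED
# BUDGET COME TO REST; SUBCRITICAL STRETCHING ALONG A TRAJECTORY KILLS ITS VORTICITY (tools for the DSS key K-A″)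

Route `EulerZoomLiouville` (NavierStokesRegularity), crux E, width seat ns-cas-k2 (g2), key K-A″ «sub-Bernoulli pressure clock»
(companion of `…SimilarityBernoulli`, which turns the pressure clock into a bound on `∫_a^{τ₀} (−s)^{1−2n}‖u + (n/(−s))X‖² ds`
along particle paths).  Physical variables, similarity exponent `n`:
* `tendsto_similaritySpeed_zero` — REST: along a backward trajectory confined to `‖X(s)‖ ≤ R(−s)ⁿ` (`s ≤ τ₀`) with bounded
  scale-invariant speed `(−s)^{1−n}‖u‖` and pressure gradient `(−s)^{2−n}‖∇p‖` and the speed budget, the similarity speed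
  `(−s)^{1−n}‖u(s,X(s)) + (n/(−s))X(s)‖ → 0` as `s → −∞`;
* `curl_eq_zero_of_eventually_subcritical` — KILL: if along the backward trajectory of `(τ₀,x₀)` eventually (`s ≤ σ₁`)
  `⟪∇u(s,X)v,v⟫ ≤ κ‖v‖²/(−s)` with `κ < 1` and `(−s)‖ω(s,X)‖ ≤ C`, then `ω(τ₀,x₀) = 0` (two-time Cauchy formula of `…VorticityBirth`).

WHAT THIS IS NOT: not NS regularity, not the crux E — Lagrangian tools for hypothetical blow-up members. [folklore;
ConstantinIgnatovaVicol2026Putative §3.4.3 (3.33); Chae2010 Thm 1.1 (stretching form)]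
-/

noncomputable section

set_option linter.dupNamespace false

open MeasureTheory Set Filter Topology Metric Function
open scoped NNReal ENNReal ContDiff InnerProductSpace RealInnerProductSpace

namespace Summit.NavierStokesRegularity.NavierStokesRegularity.Theorems.PowerGaugeEulerLiouville.SimilarityBernoulli

open Literature.Analysis Literature.Analysis.FluidPDE Literature.Analysis.FunctionSpaces
open Summit.NavierStokesRegularity.NavierStokesRegularity.Theorems.PowerGaugeEulerLiouville.VorticityBirth

/-! ### Rest: the similarity speed tends to zero along a confined trajectory with a speed budget -/

variable {u : ℝ → EuclideanSpace ℝ (Fin 3) → EuclideanSpace ℝ (Fin 3)} {p : ℝ → EuclideanSpace ℝ (Fin 3) → ℝ}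
  {X : ℝ → EuclideanSpace ℝ (Fin 3)} {n : ℝ}

/-- **REST.**  Classical Euler on `(−∞,0)`, `0 ≤ n ≤ 1`, a particle path `X` on `(−∞,0)` which for `s ≤ τ₀ < 0` is CONFINED to the
moving ball `‖X(s)‖ ≤ R(−s)ⁿ`, along which the scale-invariant speed and pressure gradient are bounded
(`(−s)^{1−n}‖u‖ ≤ A`, `(−s)^{2−n}‖∇p‖ ≤ G`) and the SPEED BUDGET `∫_a^{τ₀} (−s)^{1−2n}‖u + (n/(−s))X‖² ds ≤ M` holds for all
`a ≤ τ₀`: then the similarity speed `(−s)^{1−n}‖u(s,X(s)) + (n/(−s))X(s)‖` tends to `0` as `s → −∞`.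
[cite: ConstantinIgnatovaVicol2026Putative, §3.4.3 (3.33) (self-similar bounded trajectories come to rest)] -/
theorem tendsto_similaritySpeed_zero (hcl : IsClassicalEulerSolutionOn (Iio 0) 0 u p) (hn0 : 0 ≤ n) (hn1 : n ≤ 1)
    {τ₀ R A G M : ℝ} (hτ₀ : τ₀ < 0) (hX : ∀ s : ℝ, s < 0 → HasDerivAt X (u s (X s)) s)
    (hconf : ∀ s : ℝ, s ≤ τ₀ → ‖X s‖ ≤ R * (-s) ^ n)
    (hA : ∀ s : ℝ, s ≤ τ₀ → (-s) ^ (1 - n) * ‖u s (X s)‖ ≤ A)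
    (hG : ∀ s : ℝ, s ≤ τ₀ → (-s) ^ (2 - n) * ‖gradient (p s) (X s)‖ ≤ G)
    (hbudget : ∀ a : ℝ, a ≤ τ₀ → ∫ s in a..τ₀, (-s) ^ (1 - 2 * n) * ‖u s (X s) + (n / (-s)) • X s‖ ^ 2 ≤ M) :
    Tendsto (fun s => (-s) ^ (1 - n) * ‖u s (X s) + (n / (-s)) • X s‖) atBot (𝓝 0) := by
  have hR : 0 ≤ R := by
    have h := hconf τ₀ le_rfl
    have hpow : 0 < (-τ₀) ^ n := Real.rpow_pos_of_pos (by linarith) _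
    nlinarith [norm_nonneg (X τ₀)]
  have hA0 : 0 ≤ A := (mul_nonneg (Real.rpow_nonneg (by linarith) _) (norm_nonneg _)).trans (hA τ₀ le_rfl)
  have hG0 : 0 ≤ G := (mul_nonneg (Real.rpow_nonneg (by linarith) _) (norm_nonneg _)).trans (hG τ₀ le_rfl)
  -- the similarity velocity `V = (−s)^{1−n} (u + (n/(−s)) X)` along the path and its derivative
  set W : ℝ → EuclideanSpace ℝ (Fin 3) := fun s => u s (X s) + (n / (-s)) • X s with hW
  set V : ℝ → EuclideanSpace ℝ (Fin 3) := fun s => (-s) ^ (1 - n) • W s with hV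
  have hWd : ∀ s : ℝ, s < 0 → HasDerivAt W
      (-gradient (p s) (X s) + ((n / (-s) ^ 2) • X s + (n / (-s)) • u s (X s))) s := by
    intro s hs
    have hne : (-s) ≠ 0 := by linarith
    have h1 := hasDerivAt_velocity_comp hcl hs (hX s hs)
    have hc : HasDerivAt (fun r : ℝ => n / (-r)) (n / (-s) ^ 2) s := by
      have h := ((hasDerivAt_neg s).inv hne).const_mul n
      refine (h.congr_deriv ?_).congr_of_eventuallyEq ?_
      · field_simp
      · exact Eventually.of_forall fun r => by simp [div_eq_mul_inv]
    have h2 : HasDerivAt (fun r => (n / (-r)) • X r) ((n / (-s) ^ 2) • X s + (n / (-s)) • u s (X s)) s := by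
      have := hc.smul (hX s hs)
      rw [add_comm] at this
      exact this
    exact h1.add h2
  have hVd : ∀ s : ℝ, s < 0 → HasDerivAt V
      (((-1) * (1 - n) * (-s) ^ (1 - n - 1)) • W s +
        (-s) ^ (1 - n) • (-gradient (p s) (X s) + ((n / (-s) ^ 2) • X s + (n / (-s)) • u s (X s)))) s := by
    intro s hs
    have hne : (-s) ≠ 0 := by linarith
    have hpow : HasDerivAt (fun r : ℝ => (-r) ^ (1 - n)) ((-1) * (1 - n) * (-s) ^ (1 - n - 1)) s :=
      (hasDerivAt_neg s).rpow_const (Or.inl hne)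
    have h := hpow.smul (hWd s hs)
    rw [add_comm] at h
    exact h
  -- sizes along the confined trajectory, `s ≤ τ₀`
  have hVle : ∀ s : ℝ, s ≤ τ₀ → ‖V s‖ ≤ A + n * R := by
    intro s hs
    have hs0 : 0 < -s := by linarith
    have hp1 : 0 ≤ (-s) ^ (1 - n) := Real.rpow_nonneg hs0.le _
    have e1 : (-s) ^ (1 - n) * (n / (-s)) * ‖X s‖ ≤ n * R := by
      have h1 : (-s) ^ (1 - n) * (n / (-s)) * ‖X s‖ ≤ (-s) ^ (1 - n) * (n / (-s)) * (R * (-s) ^ n) :=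
        mul_le_mul_of_nonneg_left (hconf s hs) (mul_nonneg hp1 (div_nonneg hn0 hs0.le))
      have h2 : (-s) ^ (1 - n) * (n / (-s)) * (R * (-s) ^ n) = n * R := by
        rw [show (-s) ^ (1 - n) * (n / (-s)) * (R * (-s) ^ n) = n * R * ((-s) ^ (1 - n) * (-s) ^ n / (-s)) by ring,
          ← Real.rpow_add hs0, show (1 - n + n) = (1 : ℝ) by ring, Real.rpow_one, div_self hs0.ne', mul_one]
      linarith
    calc ‖V s‖ = (-s) ^ (1 - n) * ‖W s‖ := by
          simp only [hV]; rw [norm_smul, Real.norm_eq_abs, abs_of_nonneg hp1]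
      _ ≤ (-s) ^ (1 - n) * (‖u s (X s)‖ + (n / (-s)) * ‖X s‖) := by
          refine mul_le_mul_of_nonneg_left ?_ hp1
          simp only [hW]
          refine (norm_add_le _ _).trans ?_
          rw [norm_smul, Real.norm_eq_abs, abs_of_nonneg (div_nonneg hn0 hs0.le)]
      _ = (-s) ^ (1 - n) * ‖u s (X s)‖ + (-s) ^ (1 - n) * (n / (-s)) * ‖X s‖ := by ring
      _ ≤ A + n * R := add_le_add (hA s hs) e1
  have hV'le : ∀ s : ℝ, s ≤ τ₀ →
      ‖((-1) * (1 - n) * (-s) ^ (1 - n - 1)) • W s +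
        (-s) ^ (1 - n) • (-gradient (p s) (X s) + ((n / (-s) ^ 2) • X s + (n / (-s)) • u s (X s)))‖ ≤
        ((1 - n) * (A + n * R) + G + n * R + n * A) / (-s) := by
    intro s hs
    have hs0 : 0 < -s := by linarith
    have hp1 : 0 ≤ (-s) ^ (1 - n) := Real.rpow_nonneg hs0.le _
    -- first summand: `(1−n)(−s)^{−n} ‖W‖ = (1−n) ‖V‖/(−s)`
    have h1 : ‖((-1) * (1 - n) * (-s) ^ (1 - n - 1)) • W s‖ ≤ (1 - n) * (A + n * R) / (-s) := by
      rw [norm_smul, Real.norm_eq_abs, Real.rpow_sub_one hs0.ne',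
        show (-1) * (1 - n) * ((-s) ^ (1 - n) / (-s)) = -((1 - n) * (-s) ^ (1 - n) / (-s)) by ring, abs_neg,
        abs_of_nonneg (div_nonneg (mul_nonneg (by linarith) hp1) hs0.le)]
      have hVW : (-s) ^ (1 - n) * ‖W s‖ = ‖V s‖ := by
        simp only [hV]; rw [norm_smul, Real.norm_eq_abs, abs_of_nonneg hp1]
      rw [show (1 - n) * (-s) ^ (1 - n) / (-s) * ‖W s‖ = (1 - n) * ((-s) ^ (1 - n) * ‖W s‖) / (-s) by ring, hVW]
      exact div_le_div_of_nonneg_right (mul_le_mul_of_nonneg_left (hVle s hs) (by linarith)) hs0.le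
    -- second summand
    have h2 : ‖(-s) ^ (1 - n) • (-gradient (p s) (X s) + ((n / (-s) ^ 2) • X s + (n / (-s)) • u s (X s)))‖ ≤
        (G + n * R + n * A) / (-s) := by
      rw [norm_smul, Real.norm_eq_abs, abs_of_nonneg hp1]
      have hg : (-s) ^ (1 - n) * ‖gradient (p s) (X s)‖ ≤ G / (-s) := by
        rw [le_div_iff₀ hs0, show (-s) ^ (1 - n) * ‖gradient (p s) (X s)‖ * (-s) =
          ((-s) ^ (1 - n) * (-s)) * ‖gradient (p s) (X s)‖ by ring, ← Real.rpow_add_one hs0.ne',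
          show (1 - n + 1) = (2 - n : ℝ) by ring]
        exact hG s hs
      have hx : (-s) ^ (1 - n) * ((n / (-s) ^ 2) * ‖X s‖) ≤ n * R / (-s) := by
        have h3 : (-s) ^ (1 - n) * ((n / (-s) ^ 2) * ‖X s‖) ≤ (-s) ^ (1 - n) * ((n / (-s) ^ 2) * (R * (-s) ^ n)) :=
          mul_le_mul_of_nonneg_left (mul_le_mul_of_nonneg_left (hconf s hs) (by positivity)) hp1
        have h4 : (-s) ^ (1 - n) * ((n / (-s) ^ 2) * (R * (-s) ^ n)) = n * R / (-s) := by
          rw [show (-s) ^ (1 - n) * ((n / (-s) ^ 2) * (R * (-s) ^ n)) = n * R * ((-s) ^ (1 - n) * (-s) ^ n) / (-s) ^ 2 by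
            ring, ← Real.rpow_add hs0, show (1 - n + n) = (1 : ℝ) by ring, Real.rpow_one]
          field_simp
        linarith
      have hu : (-s) ^ (1 - n) * ((n / (-s)) * ‖u s (X s)‖) ≤ n * A / (-s) := by
        rw [show (-s) ^ (1 - n) * ((n / (-s)) * ‖u s (X s)‖) = n * ((-s) ^ (1 - n) * ‖u s (X s)‖) / (-s) by ring]
        exact div_le_div_of_nonneg_right (mul_le_mul_of_nonneg_left (hA s hs) hn0) hs0.le
      have htri : ‖-gradient (p s) (X s) + ((n / (-s) ^ 2) • X s + (n / (-s)) • u s (X s))‖ ≤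
          ‖gradient (p s) (X s)‖ + ((n / (-s) ^ 2) * ‖X s‖ + (n / (-s)) * ‖u s (X s)‖) := by
        refine (norm_add_le _ _).trans (add_le_add (by rw [norm_neg]) ((norm_add_le _ _).trans (add_le_add ?_ ?_)))
        · rw [norm_smul, Real.norm_eq_abs, abs_of_nonneg (by positivity)]
        · rw [norm_smul, Real.norm_eq_abs, abs_of_nonneg (div_nonneg hn0 hs0.le)]
      calc (-s) ^ (1 - n) * ‖-gradient (p s) (X s) + ((n / (-s) ^ 2) • X s + (n / (-s)) • u s (X s))‖
          ≤ (-s) ^ (1 - n) * (‖gradient (p s) (X s)‖ + ((n / (-s) ^ 2) * ‖X s‖ + (n / (-s)) * ‖u s (X s)‖)) :=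
            mul_le_mul_of_nonneg_left htri hp1
        _ = (-s) ^ (1 - n) * ‖gradient (p s) (X s)‖ + (-s) ^ (1 - n) * ((n / (-s) ^ 2) * ‖X s‖) +
              (-s) ^ (1 - n) * ((n / (-s)) * ‖u s (X s)‖) := by ring
        _ ≤ G / (-s) + n * R / (-s) + n * A / (-s) := add_le_add (add_le_add hg hx) hu
        _ = (G + n * R + n * A) / (-s) := by ring
    calc _ ≤ _ := norm_add_le _ _
      _ ≤ (1 - n) * (A + n * R) / (-s) + (G + n * R + n * A) / (-s) := add_le_add h1 h2
      _ = ((1 - n) * (A + n * R) + G + n * R + n * A) / (-s) := by ring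
  -- Barbalat for `g = ‖V‖²`
  set C₀ : ℝ := A + n * R with hC₀
  set C₁ : ℝ := (1 - n) * (A + n * R) + G + n * R + n * A with hC₁
  set g : ℝ → ℝ := fun s => ‖V s‖ ^ 2 with hg
  have hgd : ∀ s : ℝ, s ≤ τ₀ → HasDerivAt g (2 * ⟪V s, ((-1) * (1 - n) * (-s) ^ (1 - n - 1)) • W s +
      (-s) ^ (1 - n) • (-gradient (p s) (X s) + ((n / (-s) ^ 2) • X s + (n / (-s)) • u s (X s)))⟫) s :=
    fun s hs => (hVd s (by linarith)).norm_sq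
  have hg'le : ∀ s : ℝ, s ≤ τ₀ → |2 * ⟪V s, ((-1) * (1 - n) * (-s) ^ (1 - n - 1)) • W s +
      (-s) ^ (1 - n) • (-gradient (p s) (X s) + ((n / (-s) ^ 2) • X s + (n / (-s)) • u s (X s)))⟫| ≤
      2 * C₀ * C₁ / (-s) := by
    intro s hs
    have hs0 : 0 < -s := by linarith
    have h1 := abs_real_inner_le_norm (V s) (((-1) * (1 - n) * (-s) ^ (1 - n - 1)) • W s +
      (-s) ^ (1 - n) • (-gradient (p s) (X s) + ((n / (-s) ^ 2) • X s + (n / (-s)) • u s (X s))))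
    have h2 := mul_le_mul (hVle s hs) (hV'le s hs) (norm_nonneg _) (by rw [hC₀]; positivity)
    rw [abs_mul, abs_two]
    calc 2 * _ ≤ 2 * (‖V s‖ * _) := mul_le_mul_of_nonneg_left h1 (by norm_num)
      _ ≤ 2 * ((A + n * R) * (((1 - n) * (A + n * R) + G + n * R + n * A) / (-s))) :=
          mul_le_mul_of_nonneg_left h2 (by norm_num)
      _ = 2 * C₀ * C₁ / (-s) := by simp only [hC₀, hC₁]; ring
  have hVW : ∀ s : ℝ, s < 0 → ‖V s‖ = (-s) ^ (1 - n) * ‖W s‖ := fun s hs => by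
    simp only [hV]; rw [norm_smul, Real.norm_eq_abs, abs_of_nonneg (Real.rpow_nonneg (by linarith) _)]
  have hgq : ∀ s : ℝ, s < 0 → g s / (-s) = (-s) ^ (1 - 2 * n) * ‖W s‖ ^ 2 := by
    intro s hs
    have hs0 : 0 < -s := by linarith
    have hsne : s ≠ 0 := ne_of_lt hs
    simp only [hg]
    rw [hVW s hs, mul_pow, ← Real.rpow_natCast ((-s) ^ (1 - n)) 2, ← Real.rpow_mul hs0.le]
    push_cast
    rw [show (1 - n) * 2 = (1 - 2 * n) + 1 by ring, Real.rpow_add_one hs0.ne']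
    field_simp
  have hint : ∀ a : ℝ, a ≤ τ₀ → ∫ s in a..τ₀, g s / (-s) ≤ M := by
    intro a ha
    have e : ∫ s in a..τ₀, g s / (-s) = ∫ s in a..τ₀, (-s) ^ (1 - 2 * n) * ‖W s‖ ^ 2 :=
      intervalIntegral.integral_congr fun s hs => hgq s (by rw [uIcc_of_le ha] at hs; linarith [hs.2])
    rw [e]
    exact hbudget a ha
  have hlim := tendsto_zero_atBot_of_deriv_le_of_integral_le hτ₀ hgd hg'le (fun s _ => sq_nonneg _) hint
  -- `‖V‖ = √g → 0`
  have hsqrt : Tendsto (fun s => Real.sqrt (g s)) atBot (𝓝 0) := by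
    have := (Real.continuous_sqrt.tendsto 0).comp hlim
    rwa [Real.sqrt_zero] at this
  refine hsqrt.congr' ?_
  filter_upwards [eventually_lt_atBot (0 : ℝ)] with s hs
  simp only [hg]
  rw [Real.sqrt_sq (norm_nonneg _), hVW s hs]

/-! ### Kill: eventually subcritical stretching along a backward trajectory -/

/-- **KILL.**  Classical Euler on `(−∞,0)` with a continuous gradient majorant `Λ` (so the particle flow
`φ(s; τ₀, x₀) = ODE.evolutionMap u τ₀ s x₀` exists); if along the backward trajectory of `(τ₀, x₀)` the stretching form is
SUBCRITICAL for `s ≤ σ₁` (`⟪∇u(s, φ(s))v, v⟫ ≤ κ‖v‖²/(−s)`, `κ < 1`) and the vorticity obeys the Type-I bound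
`(−s)‖ω(s, φ(s))‖ ≤ C` there, then `ω(τ₀, x₀) = 0`. [cite: Chae2010, Thm 1.1 (stretching form, along one trajectory);
MajdaBertozziCUP2002 §1.6 (1.51)] -/
theorem curl_eq_zero_of_eventually_subcritical (hcl : IsClassicalEulerSolutionOn (Iio 0) 0 u p) {Λ : ℝ → ℝ}
    (hΛc : ContinuousOn Λ (Iio 0)) (hΛ : ∀ s : ℝ, s < 0 → ∀ y, ‖fderiv ℝ (u s) y‖ ≤ Λ s)
    {τ₀ σ₁ κ C : ℝ} (hτ₀ : τ₀ < 0) (hσ₁ : σ₁ ≤ τ₀) (hκ : κ < 1) {x₀ : EuclideanSpace ℝ (Fin 3)}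
    (hsub : ∀ s : ℝ, s ≤ σ₁ → ∀ v : EuclideanSpace ℝ (Fin 3),
      ⟪fderiv ℝ (u s) (ODE.evolutionMap u τ₀ s x₀) v, v⟫ ≤ κ / (-s) * ‖v‖ ^ 2)
    (hC : ∀ s : ℝ, s ≤ σ₁ → (-s) * ‖curl (u s) (ODE.evolutionMap u τ₀ s x₀)‖ ≤ C) :
    curl (u τ₀) x₀ = 0 := by
  have hσ₁0 : σ₁ < 0 := lt_of_le_of_lt hσ₁ hτ₀
  have hlip : ODE.IsUniformlyLipschitzOn u (Iio 0) := isUniformlyLipschitzOn hcl hΛc hΛ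
  set X : ℝ → EuclideanSpace ℝ (Fin 3) → EuclideanSpace ℝ (Fin 3) := fun s y => ODE.evolutionMap u τ₀ s y with hX
  have hXu : ∀ t ∈ Iio (0 : ℝ), ∀ y, HasDerivWithinAt (fun s => X s y) (u t (X t y)) (Iio 0) t :=
    fun t ht y => hlip.hasDerivWithinAt_evolutionMap (convex_Iio 0) hτ₀ ht y
  -- `G s = ‖ω(s, φ(s))‖²`, `P s = (−s)^{2κ}`, `F = P · G`
  set G : ℝ → ℝ := fun s => ‖curl (u s) (X s x₀)‖ ^ 2 with hG
  have hG' : ∀ s : ℝ, s < 0 →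
      HasDerivAt G (2 * ⟪curl (u s) (X s x₀), fderiv ℝ (u s) (X s x₀) (curl (u s) (X s x₀))⟫) s := by
    intro s hs
    have h1 := (hcl.hasDerivWithinAt_curl_flow (uniqueDiffOn_Iio 0) hXu (mem_Iio.2 hs) x₀).hasDerivAt
      (Iio_mem_nhds hs)
    exact h1.norm_sq
  set P : ℝ → ℝ := fun s => (-s) ^ (2 * κ) with hP
  have hP' : ∀ s : ℝ, s < 0 → HasDerivAt P ((-1) * (2 * κ) * (-s) ^ (2 * κ - 1)) s := fun s hs =>
    (hasDerivAt_neg s).rpow_const (Or.inl (by linarith))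
  set F : ℝ → ℝ := fun s => P s * G s with hF
  have hF' : ∀ s : ℝ, s < 0 → HasDerivAt F ((-1) * (2 * κ) * (-s) ^ (2 * κ - 1) * G s +
      P s * (2 * ⟪curl (u s) (X s x₀), fderiv ℝ (u s) (X s x₀) (curl (u s) (X s x₀))⟫)) s :=
    fun s hs => (hP' s hs).mul (hG' s hs)
  have hF'le : ∀ s : ℝ, s ≤ σ₁ → (-1) * (2 * κ) * (-s) ^ (2 * κ - 1) * G s +
      P s * (2 * ⟪curl (u s) (X s x₀), fderiv ℝ (u s) (X s x₀) (curl (u s) (X s x₀))⟫) ≤ 0 := by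
    intro s hs
    have hs0 : 0 < -s := by linarith
    set w := curl (u s) (X s x₀) with hw
    have hq : ⟪w, fderiv ℝ (u s) (X s x₀) w⟫ ≤ κ / (-s) * ‖w‖ ^ 2 := by
      rw [real_inner_comm]; exact hsub s hs w
    have hPw : P s * (2 * ⟪w, fderiv ℝ (u s) (X s x₀) w⟫) ≤ P s * (2 * (κ / (-s) * ‖w‖ ^ 2)) :=
      mul_le_mul_of_nonneg_left (by linarith) (Real.rpow_nonneg hs0.le _)
    have hid : P s * (2 * (κ / (-s) * ‖w‖ ^ 2)) = (2 * κ) * (-s) ^ (2 * κ - 1) * G s := by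
      simp only [hP, hG, ← hw]
      rw [Real.rpow_sub_one hs0.ne']
      field_simp
    have hG0 : G s = ‖w‖ ^ 2 := by simp only [hG, hw]
    nlinarith [hPw, hid]
  -- `F` is non-increasing on `(−∞, σ₁]`
  have hanti : AntitoneOn F (Iic σ₁) := by
    refine antitoneOn_of_hasDerivWithinAt_nonpos (convex_Iic σ₁)
      (fun s hs => (hF' s (lt_of_le_of_lt hs hσ₁0)).continuousAt.continuousWithinAt)
      (fun s hs => by
        rw [interior_Iic] at hs
        exact (hF' s (lt_of_lt_of_le hs hσ₁0.le)).hasDerivWithinAt) fun s hs => ?_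
    rw [interior_Iic] at hs
    exact hF'le s (le_of_lt hs)
  -- `F σ₁ ≤ F s ≤ C² (−s)^{2κ−2}` for `s ≤ σ₁`
  have hbound : ∀ s : ℝ, s ≤ σ₁ → F σ₁ ≤ C ^ 2 * (-s) ^ (2 * κ - 2) := by
    intro s hs
    have hs0 : 0 < -s := by linarith
    have h1 : F σ₁ ≤ F s := hanti (mem_Iic.2 hs) (mem_Iic.2 le_rfl) hs
    have hωs : ‖curl (u s) (X s x₀)‖ ≤ C / (-s) := by
      rw [le_div_iff₀ hs0, mul_comm]; exact hC s hs
    have hC0 : 0 ≤ C := le_trans (mul_nonneg hs0.le (norm_nonneg _)) (hC s hs)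
    have h2 : G s ≤ (C / (-s)) ^ 2 := by
      simp only [hG]; exact pow_le_pow_left₀ (norm_nonneg _) hωs 2
    have h3 : F s ≤ (-s) ^ (2 * κ) * (C / (-s)) ^ 2 := mul_le_mul_of_nonneg_left h2 (Real.rpow_nonneg hs0.le _)
    have h4 : (-s) ^ (2 * κ) * (C / (-s)) ^ 2 = C ^ 2 * (-s) ^ (2 * κ - 2) := by
      rw [Real.rpow_sub hs0, show (2 : ℝ) = ((2 : ℕ) : ℝ) by norm_num, Real.rpow_natCast]
      field_simp
    linarith
  have hlim : Tendsto (fun r : ℝ => C ^ 2 * r ^ (2 * κ - 2)) atTop (𝓝 0) := by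
    have h1 : Tendsto (fun r : ℝ => r ^ (-(2 - 2 * κ))) atTop (𝓝 0) := tendsto_rpow_neg_atTop (by linarith)
    have h2 := h1.const_mul (C ^ 2)
    simp only [mul_zero] at h2
    refine h2.congr fun r => ?_
    rw [show -(2 - 2 * κ) = 2 * κ - 2 by ring]
  have hFσ₁ : F σ₁ ≤ 0 := by
    refine ge_of_tendsto hlim ?_
    filter_upwards [eventually_ge_atTop (-σ₁)] with r hr
    have h := hbound (-r) (by linarith)
    rwa [neg_neg] at h
  -- hence `ω(σ₁, φ(σ₁)) = 0`
  have hGσ₁ : G σ₁ = 0 := by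
    have hPpos : 0 < P σ₁ := Real.rpow_pos_of_pos (by linarith) _
    have hG0 : 0 ≤ G σ₁ := sq_nonneg _
    have : F σ₁ = P σ₁ * G σ₁ := rfl
    nlinarith
  have hω : curl (u σ₁) (X σ₁ x₀) = 0 := by
    have : ‖curl (u σ₁) (X σ₁ x₀)‖ ^ 2 = 0 := hGσ₁
    exact norm_eq_zero.1 (pow_eq_zero_iff two_ne_zero |>.1 this)
  -- transport to `(τ₀, x₀)` by the two-time Cauchy formula
  rw [curl_eq_fderiv_evolutionMap_apply_two_time_local hcl hΛc hΛ hσ₁0 hτ₀ x₀]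
  simp only [hX] at hω
  rw [hω, map_zero]

end Summit.NavierStokesRegularity.NavierStokesRegularity.Theorems.PowerGaugeEulerLiouville.SimilarityBernoulli

end
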